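import Mathlib
import Summits.Ventures.PercRepro.PuncturedLYMTypeLiftFamily
import Summits.Ventures.PercRepro.PuncturedLYMCoHypMain

/-!
# PercRepro — (SP) FOR ANY NUMBER OF PAIRWISE DISJOINT `4`-SETS AT LEVEL `4`: COUNTING COORDINATES, CARDINALITIES
(p10, gen 40)

`cnt v a` counts the coordinates of a type `a : Fin k → ℕ` equal to `v`; a sum over the coordinates of a `{0, …, 3}`-valued
type groups by value (`sum_eq_cnt`), the counts add up to `k` (`cnt_add`), the coordinates add up to `Σ v cnt v` (`sum_coords`),
changing one coordinate moves the counts by indicators (`cnt_update`); `C(n, 4)`, `C(n, 5)`, `C(n − 4, 0)` as polynomials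
at `n = m' + 5`; the trivial case of (SP) at level `4` on at most `4` points.  Nothing here asserts (SP).
-/

namespace PercRepro.PuncturedLYM.Split.TypeLift.Unif44

open Finset

/-- The number of coordinates of `a` equal to `v`. -/
def cnt {k : ℕ} (v : ℕ) (a : Fin k → ℕ) : ℕ := (univ.filter (fun i => a i = v)).card

/-- A sum over the coordinates of a `{0, …, 3}`-valued vector, grouped by value. -/
theorem sum_eq_cnt {k : ℕ} (a : Fin k → ℕ) (ha : ∀ i, a i ≤ 3) (g : ℕ → ℚ) :
    ∑ i, g (a i) = (cnt 0 a : ℚ) * g 0 + (cnt 1 a : ℚ) * g 1 + (cnt 2 a : ℚ) * g 2 + (cnt 3 a : ℚ) * g 3 := by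
  have hmaps : ∀ i ∈ (univ : Finset (Fin k)), a i ∈ range 4 := fun i _ => mem_range.2 (by have := ha i; omega)
  rw [← sum_fiberwise_of_maps_to hmaps]
  have h : ∀ j ∈ range 4, ∑ i ∈ univ.filter (fun i => a i = j), g (a i) = (cnt j a : ℚ) * g j := by
    intro j _
    rw [sum_congr rfl (fun i hi => by rw [(mem_filter.1 hi).2]), sum_const, nsmul_eq_mul]
    rfl
  rw [sum_congr rfl h]
  simp [sum_range_succ]

/-- The counts add up to `k`. -/
theorem cnt_add {k : ℕ} (a : Fin k → ℕ) (ha : ∀ i, a i ≤ 3) : cnt 0 a + cnt 1 a + cnt 2 a + cnt 3 a = k := by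
  have h := sum_eq_cnt a ha (fun _ => 1)
  simp only [sum_const, card_univ, Fintype.card_fin, nsmul_eq_mul, mul_one] at h
  exact_mod_cast h.symm

/-- The sum of the coordinates is `Σ v · cnt v`. -/
theorem sum_coords {k : ℕ} (a : Fin k → ℕ) (ha : ∀ i, a i ≤ 3) :
    ∑ i, a i = cnt 1 a + 2 * cnt 2 a + 3 * cnt 3 a := by
  have h : ∑ i, ((a i : ℕ) : ℚ) = (cnt 0 a : ℚ) * ((0 : ℕ) : ℚ) + (cnt 1 a : ℚ) * ((1 : ℕ) : ℚ) + (cnt 2 a : ℚ) * ((2 : ℕ) : ℚ) + (cnt 3 a : ℚ) * ((3 : ℕ) : ℚ) :=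
    sum_eq_cnt a ha (fun v => (v : ℚ))
  have h' : ((∑ i, a i : ℕ) : ℚ) = ((cnt 1 a + 2 * cnt 2 a + 3 * cnt 3 a : ℕ) : ℚ) := by
    push_cast
    rw [h]
    push_cast
    ring
  exact_mod_cast h'

/-- Changing one coordinate: the count of `v` moves by the indicators of the old and the new value. -/
theorem cnt_update {k : ℕ} (v : ℕ) (a : Fin k → ℕ) (i : Fin k) (x : ℕ) :
    cnt v (Function.update a i x) + (if a i = v then 1 else 0) = cnt v a + (if x = v then 1 else 0) := by
  unfold cnt
  rw [card_filter, card_filter, ← sum_erase_add _ _ (mem_univ i), ← sum_erase_add _ _ (mem_univ i)]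
  have h : ∑ j ∈ univ.erase i, (if Function.update a i x j = v then 1 else 0) =
      ∑ j ∈ univ.erase i, (if a j = v then 1 else 0) := by
    refine sum_congr rfl (fun j hj => ?_)
    rw [Function.update_of_ne (mem_erase.1 hj).1]
  rw [h]
  simp only [Function.update_self]
  ring

/-! ### The cardinalities -/

/-- `C(n, 4)` as a polynomial, `n = m' + 5`. -/
theorem choose_l_cast (m' : ℕ) :
    (((m' + 5).choose 4 : ℕ) : ℚ) = ((m' : ℚ) + 5) * ((m' : ℚ) + 4) * ((m' : ℚ) + 3) * ((m' : ℚ) + 2) / 24 := by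
  have h := Nat.descFactorial_eq_factorial_mul_choose (m' + 5) 4
  simp only [Nat.descFactorial_succ, Nat.descFactorial_zero, Nat.factorial, mul_one] at h
  rw [show m' + 5 - 3 = m' + 2 by omega, show m' + 5 - 2 = m' + 3 by omega, show m' + 5 - 1 = m' + 4 by omega, show m' + 5 - 0 = m' + 5 by omega] at h
  have h' := congrArg (fun x : ℕ => (x : ℚ)) h
  push_cast at h'
  linarith

/-- `C(n, 5)` as a polynomial, `n = m' + 5`. -/
theorem choose_l1_cast (m' : ℕ) :
    (((m' + 5).choose 5 : ℕ) : ℚ) = ((m' : ℚ) + 5) * ((m' : ℚ) + 4) * ((m' : ℚ) + 3) * ((m' : ℚ) + 2) * ((m' : ℚ) + 1) / 120 := by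
  have h := Nat.descFactorial_eq_factorial_mul_choose (m' + 5) 5
  simp only [Nat.descFactorial_succ, Nat.descFactorial_zero, Nat.factorial, mul_one] at h
  rw [show m' + 5 - 4 = m' + 1 by omega, show m' + 5 - 3 = m' + 2 by omega, show m' + 5 - 2 = m' + 3 by omega, show m' + 5 - 1 = m' + 4 by omega, show m' + 5 - 0 = m' + 5 by omega] at h
  have h' := congrArg (fun x : ℕ => (x : ℚ)) h
  push_cast at h'
  linarith

/-- `C(n − 4, 0)` as a polynomial, `n = m' + 5`. -/
theorem choose_lm_cast (m' : ℕ) : (((m' + 1).choose 0 : ℕ) : ℚ) = 1 := by simp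

section Trivial

variable {α : Type} [Fintype α]

/-- With at most `4` points there is no column, and (SP) holds for every `D`. -/
theorem puncturedNMP_of_card_le [DecidableEq α] (D : Finset (Finset α)) (hn : Fintype.card α ≤ 4) :
    PuncturedNMP 4 D := by
  intro 𝒜 _
  have h : levelAbove α 4 = ∅ := by
    unfold levelAbove
    rw [powersetCard_eq_empty, card_univ]
    omega
  rw [h, card_empty, mul_zero]
  exact Nat.zero_le _

end Trivial

end PercRepro.PuncturedLYM.Split.TypeLift.Unif44
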